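import Mathlib.MeasureTheory.Measure.Dirac
import Mathlib.MeasureTheory.Measure.Real
import Mathlib.Combinatorics.SimpleGraph.Finite
import Mathlib.Data.ENNReal.BigOperators
import Literature.Probability.Percolation.Percolation
import HarnessLib

/-!
# Sourced even subgraphs (`T`-joins) and the sourced loop O(1) measure of a finite graph

Topic `Literature/Probability/LatticeModels` (definition item `loopO1Measure`, route
`CriticalPhenomena/Ising3DConformal…`, items 8464/8466/8467 which inline the `Finset.filter` terms
below).

Sources, read verbatim: U. T. Hansen, J. Jiang, F. R. Klausen, *A general coupling for Ising models
and beyond*, arXiv:2506.10765 (2025), §2 (held text chunk 5): "For `ω ⊂ E`, let `∂ω` denote the set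
of `v ∈ V` with odd degree in the spanning subgraph `(V, ω)` … the sources of `ω`. Let
`𝓔_A(G) = {ω ⊂ E ∣ ∂ω = A}` be the graphs with sources `A`. The sourceless configurations `𝓔_∅(G)`
will be referred to as the even subgraphs of `G`", the switching principle
`|𝓔_A(ω)| = 1[ω ∈ 𝓕_A] |𝓔_∅(ω)|` (`𝓔_A(ω)` = subgraphs of `ω` with sources `A`), and "the high
temperature expansion (also known as the loop O(1)) probability measure `ℓ_{G,t}` on `{0,1}^E`
defined by `ℓ_{G,t}[ω] ∝ ∏_{e ∈ ω} t_e 1[∂ω = ∅]` … More generally, for a set of sources `A ⊂ V`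
… `ℓ^A_{G,t}[ω] ∝ ∏_{e∈ω} t_e 1[∂ω = A]`." For `A = ∅` and homogeneous `t = p/(1 - p)` this is
Grimmett–Janson's random even subgraph (Grimmett, *Probability on Graphs*, 2nd ed., §8.7,
Thm. 8.65–8.66).

## Contents

* `oddDegVerts F` — the source set `∂F` (vertices of odd `F`-degree); `tJoins G ω A = 𝓔_A(ω)`, the
  subgraphs `F ⊆ ω ∩ E(G)` with `∂F = A` (as a `Finset` filter of `G.edgeFinset.powerset`, VERBATIM
  the term inlined by the route items); `evenSubgraphs G ω = 𝓔_∅(ω)`;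
* `loopO1Weight`, `loopO1PartitionFunction`, `loopO1Measure G t A` — the sourced loop O(1) measure
  with homogeneous edge weight `t`, `ℓ^A_{G,t}[F] = t^{|F|} 1[∂F = A] / Z^A`, as an explicit finite
  sum of Dirac masses on `Set (Sym2 V)` (like `rcMeasure`), with `loopO1Weight_nonneg`,
  `loopO1PartitionFunction_nonneg`, and `isProbabilityMeasure_loopO1Measure` (a probability
  measure as soon as `Z^A > 0`, i.e. some `T`-join exists and `t > 0`) PROVED, and the support
  statement `loopO1Measure_apply_compl_eq_zero`.

## Not here (dictionary facts, to be filed as cite items over these definitions)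

The trace of the sourced random current `P̂^A_{G,J} = ℓ^A_{G,tanh J} ∪ P_{G,1-√(1-t²)}`
(HJK §2 (2.5), Aizenman–Duminil-Copin–Tassion–Warzel 2019) and the sourced Grimmett–Janson coupling
(uniform `T`-join of `φ_{p,2}[· ∣ 𝓕_A]` is `ℓ^A_{G,t}`, `t = p/(2 - p)`; HJK Thm. 2.? (a),
Grimmett Thm. 8.66 for `A = ∅`); inhomogeneous weights `(t_e)`.

## References

* U. T. Hansen, J. Jiang, F. R. Klausen, arXiv:2506.10765, §2. [HansenJiangKlausen2025]
* G. Grimmett, *Probability on Graphs*, 2nd ed. (2018), §8.7, Thm. 8.65–8.66. [Grimmett2018]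
* G. Grimmett, S. Janson, *Random even graphs*, Electron. J. Combin. 16 (2009), arXiv:0709.3039.
  [GrimmettJanson2007]
-/

noncomputable section

open MeasureTheory Finset

namespace Literature.Probability.LatticeModels

variable {V : Type*} [Fintype V] [DecidableEq V]

/-! ### Sources and `T`-joins -/

/-- The SOURCE SET `∂F` of an edge set `F`: the vertices of odd degree in the spanning subgraph
`(V, F)` (HJK §2). [cite: HansenJiangKlausen2025, §2] -/
def oddDegVerts (F : Finset (Sym2 V)) : Finset V :=
  Finset.univ.filter fun v => Odd #(F.filter (v ∈ ·))

/-- Membership in the source set: `v ∈ ∂F` iff `v` has odd `F`-degree. [cite: HansenJiangKlausen2025, §2] -/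
@[simp] theorem mem_oddDegVerts (F : Finset (Sym2 V)) (v : V) :
    v ∈ oddDegVerts F ↔ Odd #(F.filter (v ∈ ·)) := by
  simp [oddDegVerts]

/-- The empty edge set has no sources. [cite: HansenJiangKlausen2025, §2] -/
@[simp] theorem oddDegVerts_empty : oddDegVerts (∅ : Finset (Sym2 V)) = ∅ := by
  ext v
  simp [oddDegVerts]

variable (G : SimpleGraph V) [DecidableRel G.Adj]

/-- **`𝓔_A(ω)`, the `T`-joins of `ω` with terminal set `A`**: the edge sets `F ⊆ ω ∩ E(G)` whose
source set is `A` (`Odd (deg_F v) ↔ v ∈ A` for every `v`) — VERBATIM the `Finset.filter` term of the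
route items (HJK §2: "`𝓔_A(G) = {ω ⊂ E ∣ ∂ω = A}`", applied inside `ω`).
[cite: HansenJiangKlausen2025, §2] -/
def tJoins (ω : Set (Sym2 V)) (A : Finset V) : Finset (Finset (Sym2 V)) :=
  open scoped Classical in
  G.edgeFinset.powerset.filter fun F => (↑F : Set (Sym2 V)) ⊆ ω ∧ ∀ v, Odd #(F.filter (v ∈ ·)) ↔ v ∈ A

/-- Membership in `tJoins`. [cite: HansenJiangKlausen2025, §2] -/
theorem mem_tJoins {ω : Set (Sym2 V)} {A : Finset V} {F : Finset (Sym2 V)} :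
    F ∈ tJoins G ω A ↔ F ⊆ G.edgeFinset ∧ (↑F : Set (Sym2 V)) ⊆ ω ∧ ∀ v, Odd #(F.filter (v ∈ ·)) ↔ v ∈ A := by
  classical
  simp only [tJoins, Finset.mem_filter, Finset.mem_powerset]

/-- The source condition of `tJoins` is `∂F = A`. [cite: HansenJiangKlausen2025, §2] -/
theorem mem_tJoins_iff_oddDegVerts {ω : Set (Sym2 V)} {A : Finset V} {F : Finset (Sym2 V)} :
    F ∈ tJoins G ω A ↔ F ⊆ G.edgeFinset ∧ (↑F : Set (Sym2 V)) ⊆ ω ∧ oddDegVerts F = A := by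
  rw [mem_tJoins]
  refine and_congr_right fun _ => and_congr_right fun _ => ?_
  rw [Finset.ext_iff]
  simp only [mem_oddDegVerts]

/-- **`𝓔_∅(ω)`, the even subgraphs of `ω`** (all degrees even). [cite: HansenJiangKlausen2025, §2] -/
abbrev evenSubgraphs (ω : Set (Sym2 V)) : Finset (Finset (Sym2 V)) :=
  tJoins G ω ∅

/-- The empty edge set is an even subgraph of every `ω` (so `𝓔_∅(ω) ≠ ∅`). [cite: HansenJiangKlausen2025, §2] -/
theorem empty_mem_evenSubgraphs (ω : Set (Sym2 V)) : (∅ : Finset (Sym2 V)) ∈ evenSubgraphs G ω := by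
  rw [mem_tJoins]
  simp

/-! ### The sourced loop O(1) measure -/

/-- The loop O(1) weight `t^{|F|} 1[F ⊆ E(G), ∂F = A]` of an edge set (HJK §2, display defining
`ℓ^A_{G,t}`, homogeneous `t_e = t`). [cite: HansenJiangKlausen2025, §2] -/
def loopO1Weight (t : ℝ) (A : Finset V) (F : Finset (Sym2 V)) : ℝ :=
  if F ∈ tJoins G Set.univ A then t ^ #F else 0

/-- Loop O(1) weights are nonnegative for `t ≥ 0`. [cite: HansenJiangKlausen2025, §2] -/
theorem loopO1Weight_nonneg {t : ℝ} (ht : 0 ≤ t) (A : Finset V) (F : Finset (Sym2 V)) :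
    0 ≤ loopO1Weight G t A F := by
  unfold loopO1Weight
  split_ifs
  · positivity
  · exact le_rfl

/-- The sourced loop O(1) partition function `Z^A_{G,t} = ∑_{F ⊆ E(G), ∂F = A} t^{|F|}`
(HJK §2). [cite: HansenJiangKlausen2025, §2] -/
def loopO1PartitionFunction (t : ℝ) (A : Finset V) : ℝ :=
  ∑ F ∈ G.edgeFinset.powerset, loopO1Weight G t A F

/-- The partition function is nonnegative for `t ≥ 0`. [cite: HansenJiangKlausen2025, §2] -/
theorem loopO1PartitionFunction_nonneg {t : ℝ} (ht : 0 ≤ t) (A : Finset V) :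
    0 ≤ loopO1PartitionFunction G t A :=
  Finset.sum_nonneg fun F _ => loopO1Weight_nonneg G ht A F

/-- With no sources the partition function is positive for `t ≥ 0` (the empty even subgraph has
weight `1`). [cite: HansenJiangKlausen2025, §2] -/
theorem loopO1PartitionFunction_empty_pos {t : ℝ} (ht : 0 ≤ t) :
    0 < loopO1PartitionFunction G t ∅ := by
  refine Finset.sum_pos' (fun F _ => loopO1Weight_nonneg G ht ∅ F) ⟨∅, Finset.empty_mem_powerset _, ?_⟩
  simp [loopO1Weight, empty_mem_evenSubgraphs]

/-- **The sourced loop O(1) (high-temperature expansion) measure `ℓ^A_{G,t}`** on edge sets of the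
finite graph `G`: `ℓ^A_{G,t}[F] = t^{|F|} 1[∂F = A] / Z^A_{G,t}` (HJK §2; for `A = ∅` and
`t = p/(1-p)` Grimmett's random even subgraph, §8.7), as the explicit finite sum of Dirac masses
(cf. `rcMeasure`). A probability measure whenever `Z^A_{G,t} > 0`
(`isProbabilityMeasure_loopO1Measure`); the zero measure (junk) when no `T`-join with terminal set
`A` exists or `t` makes `Z^A = 0`. [cite: HansenJiangKlausen2025, §2] -/
def loopO1Measure (t : ℝ) (A : Finset V) : Measure (Set (Sym2 V)) :=
  ∑ F ∈ G.edgeFinset.powerset,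
    ENNReal.ofReal (loopO1Weight G t A F / loopO1PartitionFunction G t A) •
      Measure.dirac (↑F : Set (Sym2 V))

/-- Total mass: for `t ≥ 0` and `Z^A > 0`, `ℓ^A_{G,t}` is a probability measure.
[cite: HansenJiangKlausen2025, §2] -/
theorem isProbabilityMeasure_loopO1Measure {t : ℝ} (ht : 0 ≤ t) {A : Finset V}
    (hZ : 0 < loopO1PartitionFunction G t A) : IsProbabilityMeasure (loopO1Measure G t A) := by
  constructor
  simp only [loopO1Measure, Measure.coe_finsetSum, Measure.coe_smul, Finset.sum_apply,
    Pi.smul_apply, measure_univ, smul_eq_mul, mul_one]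
  rw [← ENNReal.ofReal_sum_of_nonneg
    (fun F _ => div_nonneg (loopO1Weight_nonneg G ht A F) hZ.le),
    ← Finset.sum_div, ← loopO1PartitionFunction, div_self hZ.ne', ENNReal.ofReal_one]

/-- The sourceless loop O(1) measure `ℓ_{G,t} = ℓ^∅_{G,t}` is a probability measure for every `t ≥ 0`.
[cite: HansenJiangKlausen2025, §2] -/
theorem isProbabilityMeasure_loopO1Measure_empty {t : ℝ} (ht : 0 ≤ t) :
    IsProbabilityMeasure (loopO1Measure G t ∅) :=
  isProbabilityMeasure_loopO1Measure G ht (loopO1PartitionFunction_empty_pos G ht)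

end Literature.Probability.LatticeModels
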